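import Summits.ResolutionOfSingularities.ResolutionOfSingularities.Theorems.FrobeniusClosingPatchingRelPerfectRoofEngine
import Summits.ResolutionOfSingularities.ResolutionOfSingularities.Theorems.FrobeniusClosingPatchingRelPerfectBlowupBaseChange
import Summits.ResolutionOfSingularities.ResolutionOfSingularities.Theorems.PatchingRelPerfect.Negative.PunctualAtom
import Literature.AlgebraicGeometry.Resolution.BlowupsComposition
import Literature.AlgebraicGeometry.Resolution.GenericFibreResolutionDatum
import Literature.AlgebraicGeometry.Resolution.KollarFunctorLinearCentre
import HarnessLib

/-!
# Crux `PatchingRelPerfect` (stmt-ResolutionOfSingularities-16161), chain w52: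
# P0 re-glue stub β — the roof engine in BLOW-UP FORM (`stub_roofEngineBlowup`)

[OURS · L1 W5.2 · stub β] In the planner's v4 proposal P0 (CHAIN.md v0.1 §3) the algebraized atom
is only available in BLOW-UP FORM (`PunctualPerfClosedBlowup p 4`: the local scheme `T` must be
a blowing up `Bl_I Spec S`, `I ≠ 0`).  Temkin's Noetherian induction (landed `stub_roofEngine`,
p169738) already carries the current model `f : X' → M` as a blowing up along an ideal sheaf `J₀`;
if moreover the regular ROOF `q : M → N` at the closed bad point is a blowing up along `I₀`
(`RoofEngineBlowup p`: supplied by W4′ `exists_roof_isBlowup`), then `X' → N` is a blowing up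
(Stacks 080B, `IsBlowup.exists_isBlowup_comp`), so is its flat base change
`T = X' ×_N Spec 𝒪_{N,n} → Spec 𝒪_{N,n}` (W4, `IsBlowup.pullback_snd_of_flat` with
`flat_fromSpecStalk`), along `Ĩ` for an ideal `I ⊆ 𝒪_{N,n}` (`affineBlowup.exists_eq_idealSheaf`)
which is non-zero because `T` is non-empty.  Everything else is the landed closed step / engine
VERBATIM (p169477, p169738):

* `stub_roofEngineClosedStepBlowup` — the closed step fed by the blow-up-form atom;
* `stub_roofEngineBlowup` — `LocalDesingNonClosedFour → PunctualPerfClosedBlowup p 4 →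
  RoofEngineBlowup p`, unfolded (typed targets `ChainW52.PunctualPerfClosedBlowup`,
  `ChainW52.RoofEngineBlowup`).

Nothing here is a statement of the manuscript under review; no definition or named fact is
introduced.

## Sources

* M. Temkin, Adv. Math. 219 (2008), §2.1 (Lemma 2.1.1), Prop. 2.3.4 (proof, p. 12). [Temkin2008]
* The Stacks Project, Tags 080B, 01J7. [StacksProject]
* U. Görtz, T. Wedhorn, *Algebraic Geometry I* (2nd ed., 2020), Prop. 13.91, (13.19). [GortzWedhorn2020]
-/

set_option linter.dupNamespace false -- single-problem summit: doubled namespace component is forced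

noncomputable section

open CategoryTheory CategoryTheory.Limits AlgebraicGeometry Literature.AlgebraicGeometry.Resolution
open TopologicalSpace IsLocalRing
open Summit.ResolutionOfSingularities.ResolutionOfSingularities.Theorems.PatchingRelPerfect.Negative
  (isBlowup_ne_bot_of_nonempty)

namespace Summit.ResolutionOfSingularities.ResolutionOfSingularities.Theorems

/-! ## The closed step, blow-up form -/

/-- **The roof engine, CLOSED STEP, blow-up form.** As the landed `stub_roofEngineClosedStep`
(Temkin 2008, proof of Prop. 2.3.4 over the base `N` at `n = q x`), with the atom `hB` available
only for local schemes which are blowing ups of `Spec S` along non-zero ideals: the roof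
`q : M → N` is a blowing up along `I₀` and the current model `f : X' → M` one along `J₀`, so
`f ≫ q` is a blowing up (Stacks 080B) and `T = X' ×_N Spec 𝒪_{N,n} → Spec 𝒪_{N,n}` is the
blowing up along `Ĩ`, `I ⊆ 𝒪_{N,n}` a non-zero ideal (flat base change; `T ≠ ∅`). The rest —
`T` integral, proper birational, regular off the closed fibre; extension of the atom's centre to
`X'` (Lemma 2.1.1); regularity of `Bl X'` over the generizations of `n` and off the centre — is
the landed proof verbatim. [cite: Temkin2008, Prop. 2.3.4 (proof, p. 12) and Lemma 2.1.1]
[cite: StacksProject, Tag 080B] -/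
theorem stub_roofEngineClosedStepBlowup (p : ℕ)
    (hB : ∀ (k : Type) [Field k] [CharP k p] [PerfectField k] (S : Type) [CommRing S]
      [IsRegularLocalRing S] [Algebra k S] [Algebra.EssFiniteType k S], ringKrullDim S ≤ (4 : ℕ) →
      Module.Finite k (S ⧸ IsLocalRing.maximalIdeal S) → ∀ (I : Ideal S), I ≠ ⊥ →
      ∀ (T : Scheme.{0}) (f : T ⟶ Spec (.of S)), IsBlowup f (affineBlowup.idealSheaf I) →
        (∀ t : T, f.base t ≠ IsLocalRing.closedPoint S → IsRegularLocalRing (T.presheaf.stalk t)) →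
        ∃ (J : T.IdealSheafData) (T' : Scheme.{0}) (π : T' ⟶ T), J ≠ ⊥ ∧
          (∀ t : T, t ∈ J.support → f.base t = IsLocalRing.closedPoint S) ∧
          IsBlowup π J ∧ Scheme.IsRegular T')
    (k : Type) [Field k] [CharP k p] [PerfectField k] {M N X' : Scheme.{0}}
    (gN : N ⟶ Spec (.of k)) [LocallyOfFiniteType gN] [QuasiCompact gN] [IsIntegral N]
    (hdimN : topologicalKrullDim N ≤ 4) (q : M ⟶ N) [IsProper q] (hqbir : IsBirational q)
    {I₀ : N.IdealSheafData} (hqI : IsBlowup q I₀)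
    [IsIntegral M] (f : X' ⟶ M) [IsProper f] [IsIntegral X'] (hfbir : IsBirational f)
    {J₀ : M.IdealSheafData} (hfJ : IsBlowup f J₀)
    (C : Set M) (hC : ∀ c ∈ C, IsClosed ({c} : Set M)) (hηC : genericPoint M ∉ C)
    (hreg : ∀ x' : X', f x' ∉ C → x' ∈ Scheme.regularLocus X') (x : M) (hxC : x ∈ C)
    (hregN : IsRegularLocalRing (N.presheaf.stalk (q x))) :
    ∃ (X'' : Scheme.{0}) (f' : X'' ⟶ X') (J' : X'.IdealSheafData), IsBlowup f' J' ∧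
      genericPoint M ∉ f '' (J'.support : Set X') ∧
      ∀ x'' : X'', x'' ∉ Scheme.regularLocus X'' → f (f' x'') ∈ C ∧ f (f' x'') ≠ x := by
  -- everything in sight is Noetherian
  haveI : IsNoetherian N := Scheme.isNoetherian_of_finiteType_over_field gN
  haveI : IsNoetherian M := Scheme.isNoetherian_of_finiteType_over_field (q ≫ gN)
  haveI : IsNoetherian X' := Scheme.isNoetherian_of_finiteType_over_field ((f ≫ q) ≫ gN)
  -- the roof point `n = q x` is closed, as is `q m` for every `m ∈ C`
  set n : N := q x with hn
  have hCn : ∀ m ∈ C, q m ⤳ n → q m = n := fun m hm hmn => by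
    have h1 : IsClosed ({q m} : Set N) := by
      simpa only [Set.image_singleton] using q.isClosedMap _ (hC m hm)
    have h2 : n ∈ closure ({q m} : Set N) := hmn.mem_closure
    rw [h1.closure_eq, Set.mem_singleton_iff] at h2
    exact h2.symm
  have hncl : IsClosed ({n} : Set N) := by
    simpa only [Set.image_singleton] using q.isClosedMap _ (hC x hxC)
  -- `q η_M ≠ n`: `q` is injective on the dense open `q⁻¹(U) ∋ η_M` over which it is an isomorphism
  have hqη : q (genericPoint M) ≠ n := by
    intro hq
    obtain ⟨U, -, hU', hiso⟩ := hqbir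
    haveI := hiso
    have hηU : genericPoint M ∈ ((q ⁻¹ᵁ U : M.Opens) : Set M) :=
      genericPoint_mem_of_isOpen (q ⁻¹ᵁ U).2 hU'.nonempty
    have hxU : x ∈ ((q ⁻¹ᵁ U : M.Opens) : Set M) := by
      change q x ∈ (U : Set N)
      rw [← hn, ← hq]
      exact hηU
    have hinj := (ConcreteCategory.bijective_of_isIso (q ∣_ U).base).1
    have heq : (⟨genericPoint M, hηU⟩ : ↥(q ⁻¹ᵁ U)) = ⟨x, hxU⟩ := by
      apply hinj
      apply Subtype.ext
      rw [morphismRestrict_base_coe, morphismRestrict_base_coe]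
      change q (genericPoint M) = q x
      rw [hq, hn]
    have heq' : genericPoint M = x := congrArg Subtype.val heq
    exact hηC (heq' ▸ hxC)
  -- the local scheme `T = X' ×_N Spec 𝒪_{N,n}` over the roof point
  haveI : Flat (N.fromSpecStalk n) := flat_fromSpecStalk N n
  haveI : IsNoetherian (pullback (f ≫ q) (N.fromSpecStalk n)) := {}
  have hfq : IsBirational (f ≫ q) := hfbir.comp hqbir
  haveI hTint : IsIntegral (pullback (f ≫ q) (N.fromSpecStalk n)) :=
    isIntegral_pullback_fromSpecStalk (f ≫ q) hfq n
  have hTbir : IsBirational (pullback.snd (f ≫ q) (N.fromSpecStalk n)) :=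
    isBirational_pullback_snd_fromSpecStalk (f ≫ q) hfq n
  have hfj : ∀ s : ↑(pullback (f ≫ q) (N.fromSpecStalk n)),
      q (f (pullback.fst (f ≫ q) (N.fromSpecStalk n) s)) =
        N.fromSpecStalk n (pullback.snd (f ≫ q) (N.fromSpecStalk n) s) := fun s => by
    rw [← Scheme.Hom.comp_apply, ← Scheme.Hom.comp_apply, pullback.condition,
      Scheme.Hom.comp_apply]
  -- `T` is regular off the closed fibre: `C` consists of closed points
  have hoff : ∀ t : ↑(pullback (f ≫ q) (N.fromSpecStalk n)),
      pullback.snd (f ≫ q) (N.fromSpecStalk n) t ≠ closedPoint (N.presheaf.stalk n) →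
        IsRegularLocalRing ((pullback (f ≫ q) (N.fromSpecStalk n)).presheaf.stalk t) := by
    intro t ht
    have h1 : N.fromSpecStalk n (pullback.snd (f ≫ q) (N.fromSpecStalk n) t) ≠ n := fun h =>
      ht ((N.fromSpecStalk n).isEmbedding.injective
        (h.trans Scheme.fromSpecStalk_closedPoint.symm))
    have h2 : N.fromSpecStalk n (pullback.snd (f ≫ q) (N.fromSpecStalk n) t) ⤳ n :=
      Scheme.range_fromSpecStalk.le ⟨_, rfl⟩
    have h3 : f (pullback.fst (f ≫ q) (N.fromSpecStalk n) t) ∉ C := fun hm =>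
      h1 (by rw [← hfj]; exact hCn _ hm (hfj t ▸ h2))
    exact (Scheme.mem_regularLocus _).mp
      ((mem_regularLocus_iff_pullback_fst_fromSpecStalk (f ≫ q) n t).mpr (hreg _ h3))
  -- the base `S = 𝒪_{N,n}`: regular local, essentially of finite type over `k`, `dim ≤ 4`,
  -- residue field finite over `k`
  letI : N.Over (Spec (.of k)) := ⟨gN⟩
  haveI : LocallyOfFiniteType (N ↘ Spec (.of k)) := ‹LocallyOfFiniteType gN›
  letI := stalkAlgebra (overHom k N) n
  haveI : Algebra.EssFiniteType k (N.presheaf.stalk n) := essFiniteType_stalk_overHom k N n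
  haveI : IsRegularLocalRing (N.presheaf.stalk n) := hregN
  have hfin : Module.Finite k (N.presheaf.stalk n ⧸ maximalIdeal (N.presheaf.stalk n)) :=
    finite_residue_stalk_overHom k N n hncl
  have hdimS : ringKrullDim (N.presheaf.stalk n) ≤ (4 : ℕ) :=
    (ringKrullDim_stalk_le_topologicalKrullDim N n).trans (by exact_mod_cast hdimN)
  -- BLOW-UP FORM: `X' → M → N` is a blowing up (Stacks 080B), hence so is its flat base change
  -- `T → Spec 𝒪_{N,n}` (W4), along the ideal sheaf `Ĩ` of a non-zero ideal `I ⊆ 𝒪_{N,n}`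
  obtain ⟨Q, hQ, -⟩ := hqI.exists_isBlowup_comp hfJ
  have hTbl : IsBlowup (pullback.snd (f ≫ q) (N.fromSpecStalk n))
      (Q.comap (N.fromSpecStalk n)) := hQ.pullback_snd_of_flat _
  obtain ⟨I, hIQ⟩ := affineBlowup.exists_eq_idealSheaf
    (R := N.presheaf.stalk n) (Q.comap (N.fromSpecStalk n))
  have hTbl' : IsBlowup (pullback.snd (f ≫ q) (N.fromSpecStalk n))
      (affineBlowup.idealSheaf I) := by
    exact hIQ ▸ hTbl
  have hI : I ≠ ⊥ := fun h0 =>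
    isBlowup_ne_bot_of_nonempty hTbl' ((affineBlowup.idealSheaf_eq_bot_iff (I := I)).mpr h0)
  -- the atom in blow-up form: a fibre-supported blowing up of `T` with regular source
  obtain ⟨JT, T', π, -, hJTsupp, hπ, hT'reg⟩ := hB k (N.presheaf.stalk n) hdimS hfin I hI
    (pullback (f ≫ q) (N.fromSpecStalk n)) (pullback.snd (f ≫ q) (N.fromSpecStalk n)) hTbl' hoff
  -- extend its centre to `X'` (Lemma 2.1.1) and blow `X'` up along the extension
  obtain ⟨J', hJ'JT, hJ'supp⟩ := exists_idealSheaf_extension_fromSpecStalk (f ≫ q) n JT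
  obtain ⟨X'', f', hf'⟩ := exists_isBlowup X' J'
  -- the new centre lies over `q⁻¹(n)`
  have hJ'n : ∀ x' ∈ (J'.support : Set X'), q (f x') = n := by
    have hcl : IsClosed ((f ≫ q) ⁻¹' {n}) := hncl.preimage (f ≫ q).continuous
    have hsub : pullback.fst (f ≫ q) (N.fromSpecStalk n) '' (JT.support : Set _) ⊆
        (f ≫ q) ⁻¹' {n} := by
      rintro _ ⟨s, hs, rfl⟩
      rw [Set.mem_preimage, Set.mem_singleton_iff, Scheme.Hom.comp_apply, hfj, hJTsupp s hs,
        Scheme.fromSpecStalk_closedPoint]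
    intro x' hx'
    rw [hJ'supp] at hx'
    have := hcl.closure_subset_iff.mpr hsub hx'
    rwa [Set.mem_preimage, Set.mem_singleton_iff, Scheme.Hom.comp_apply] at this
  refine ⟨X'', f', J', hf', ?_, fun x'' hx'' => ?_⟩
  · rintro ⟨x', hx', hη⟩
    exact hqη (by rw [← hη]; exact hJ'n x' hx')
  -- over the generizations of `n`, `X''` is regular: `X'' ×_{X'} T ≅ T'`
  have hb : ¬ q (f (f' x'')) ⤳ n := by
    intro hsp
    apply hx''
    have hrange : f' x'' ∈ Set.range (pullback.fst (f ≫ q) (N.fromSpecStalk n)) := by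
      rw [range_pullback_fst_fromSpecStalk]
      change (f ≫ q) (f' x'') ⤳ n
      rwa [Scheme.Hom.comp_apply]
    obtain ⟨s, hs⟩ := hrange
    have hT' : IsBlowup (pullback.snd f' (pullback.fst (f ≫ q) (N.fromSpecStalk n))) JT := by
      rw [← hJ'JT]
      exact hf'.pullback_snd_of_flat _
    obtain ⟨e, -, -⟩ := hT'.unique hπ
    have hx''range :
        x'' ∈ Set.range (pullback.fst f' (pullback.fst (f ≫ q) (N.fromSpecStalk n))) := by
      rw [Scheme.Pullback.range_fst]
      exact ⟨s, hs⟩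
    obtain ⟨t, rfl⟩ := hx''range
    refine (mem_regularLocus_iff_of_flat_of_isPreimmersion _ t).mp ?_
    exact (mem_regularLocus_iff_of_flat_of_isPreimmersion e.hom t).mpr (hT'reg _)
  refine ⟨?_, fun h => hb (by rw [h])⟩
  -- over `M ∖ C`: `X'` is regular there and `f'` is an isomorphism off its centre
  by_contra hm
  have h1 : f' x'' ∈ Scheme.regularLocus X' := hreg _ hm
  have h2 : f' x'' ∉ (J'.support : Set X') := fun h => hb (by rw [hJ'n _ h])
  haveI := hf'.isIso_compl
  exact hx'' ((mem_regularLocus_iff_of_isIso_morphismRestrict f'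
    ⟨(J'.support : Set X')ᶜ, J'.support.isClosed.isOpen_compl⟩ x'' h2).mpr h1)

/-! ## The engine, blow-up form -/

/-- **P0 stub β `stub_roofEngineBlowup` — the roof engine with BLOW-UP roofs and the blow-up-form
atom** (`LocalDesingNonClosedFour → PunctualPerfClosedBlowup p 4 → RoofEngineBlowup p`,
unfolded). For `k` perfect of characteristic `p` and an integral separated `k`-scheme `M` of finite
type with `dim M = 4` whose every CLOSED point `m` has a regular roof `q : M → N` which is a
blowing up along a non-zero ideal sheaf, `M` has a resolution of singularities — given local
desingularizations at non-closed points (`hE`) and the blow-up-form algebraized atom (`hB`).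
Temkin's Noetherian induction exactly as in the landed `stub_roofEngine` (the current model is
carried as a blowing up `IsBlowup f J`), with the closed step `stub_roofEngineClosedStepBlowup`.
[cite: Temkin2008, Prop. 2.3.4 and its proof, Lemma 2.1.1, Lemma 2.1.4] -/
theorem stub_roofEngineBlowup (p : ℕ) (hp : p.Prime)
    (hE : ∀ (k : Type) [Field k] (M : Scheme.{0}) (g : M ⟶ Spec (.of k)) [IsSeparated g]
      [LocallyOfFiniteType g] [QuasiCompact g] [IsIntegral M], topologicalKrullDim M = 4 →
      ∀ ζ : M, ¬ IsClosed ({ζ} : Set M) →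
      ∀ (X' : Scheme.{0}) (f : X' ⟶ M) (J : M.IdealSheafData), IsBlowup f J →
        Scheme.AdmitsDesingularization (pullback f (M.fromSpecStalk ζ)))
    (hB : ∀ (k : Type) [Field k] [CharP k p] [PerfectField k] (S : Type) [CommRing S]
      [IsRegularLocalRing S] [Algebra k S] [Algebra.EssFiniteType k S], ringKrullDim S ≤ (4 : ℕ) →
      Module.Finite k (S ⧸ IsLocalRing.maximalIdeal S) → ∀ (I : Ideal S), I ≠ ⊥ →
      ∀ (T : Scheme.{0}) (f : T ⟶ Spec (.of S)), IsBlowup f (affineBlowup.idealSheaf I) →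
        (∀ t : T, f.base t ≠ IsLocalRing.closedPoint S → IsRegularLocalRing (T.presheaf.stalk t)) →
        ∃ (J : T.IdealSheafData) (T' : Scheme.{0}) (π : T' ⟶ T), J ≠ ⊥ ∧
          (∀ t : T, t ∈ J.support → f.base t = IsLocalRing.closedPoint S) ∧
          IsBlowup π J ∧ Scheme.IsRegular T')
    (k : Type) [Field k] [CharP k p] [PerfectField k] (M : Scheme.{0}) (g : M ⟶ Spec (.of k))
    [IsSeparated g] [LocallyOfFiniteType g] [QuasiCompact g] [IsIntegral M]
    (hdim : topologicalKrullDim M = 4)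
    (hroof : ∀ m : M, IsClosed ({m} : Set M) →
      ∃ (N : Scheme.{0}) (gN : N ⟶ Spec (.of k)) (q : M ⟶ N) (I : N.IdealSheafData),
        IsSeparated gN ∧ LocallyOfFiniteType gN ∧ QuasiCompact gN ∧ IsIntegral N ∧
        q ≫ gN = g ∧ IsProper q ∧ IsBirational q ∧ topologicalKrullDim N ≤ 4 ∧
        IsRegularLocalRing (N.presheaf.stalk (q.base m)) ∧ I ≠ ⊥ ∧ IsBlowup q I) :
    Scheme.HasResolution M := by
  have _ := hp -- the primality of `p` is not used by the engine
  -- `M` is Noetherian, its singular locus `T` is closed and misses the generic point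
  haveI : IsNoetherian M := Scheme.isNoetherian_of_finiteType_over_field g
  have hk : Scheme.IsQuasiExcellent (Spec (.of k)) :=
    Scheme.isQuasiExcellent_of_locallyOfFiniteType Stacks07QW_field_holds (𝟙 _)
  set T : Set M := (Scheme.regularLocus M)ᶜ with hT
  have hTc : IsClosed T := isClosed_compl_regularLocus_of_locallyOfFiniteType g hk
  have hηT : genericPoint M ∉ T := fun h => h (genericPoint_mem_regularLocus M)
  -- the induction statement
  suffices H : ∀ C : Closeds M, (C : Set M) ⊆ T →
      (∃ (X' : Scheme.{0}) (f : X' ⟶ M) (J : M.IdealSheafData), IsBlowup f J ∧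
        genericPoint M ∉ (J.support : Set M) ∧
        ∀ x' : X', f x' ∉ C → x' ∈ Scheme.regularLocus X') →
      Scheme.HasResolution M by
    refine H ⟨T, hTc⟩ subset_rfl ⟨M, 𝟙 M, ⊤, isBlowup_id_top M, ?_, fun x' hx' => ?_⟩
    · simp [Scheme.IdealSheafData.support_top]
    · simpa [hT] using hx'
  intro C
  induction C using WellFoundedLT.induction with
  | ind C ih =>
  intro hCT ⟨X', f, J, hf, hηJ, hreg⟩
  -- `J ≠ 0`, so `X'` is integral and `f` is proper birational
  have hne : J ≠ ⊥ := by
    rintro rfl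
    apply hηJ
    rw [Scheme.IdealSheafData.support_bot]
    trivial
  haveI : IsIntegral X' := hf.isIntegral hne
  haveI : IsProper f := hf.isProper
  haveI : IsNoetherian X' := Scheme.isNoetherian_of_finiteType_over_field (f ≫ g)
  -- either `X'` is already regular …
  by_cases hall : ∀ x' : X', x' ∈ Scheme.regularLocus X'
  · exact ⟨X', f, hf.isResolution' stacks02NS_holds hne fun x' =>
      (Scheme.mem_regularLocus x').mp (hall x')⟩
  -- … or `C` is nonempty
  push Not at hall
  obtain ⟨x₁, hx₁⟩ := hall
  have hx₁C : f x₁ ∈ (C : Set M) := by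
    by_contra h
    exact hx₁ (hreg x₁ h)
  have hηC : genericPoint M ∉ (C : Set M) := fun h => hηT (hCT h)
  -- THE STEP at a suitable point `x ∈ C`
  obtain ⟨x, hxC, X'', f', J', hf', hηJ', hstep⟩ : ∃ x ∈ (C : Set M),
      ∃ (X'' : Scheme.{0}) (f' : X'' ⟶ X') (J' : X'.IdealSheafData), IsBlowup f' J' ∧
        genericPoint M ∉ f '' (J'.support : Set X') ∧
        ∀ x'' : X'', x'' ∉ Scheme.regularLocus X'' →
          f (f' x'') ∈ (C : Set M) ∧ f (f' x'') ≠ x := by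
    by_cases hC : ∃ c ∈ (C : Set M), ¬ IsClosed ({c} : Set M)
    · -- NON-CLOSED STEP at a non-closed maximal point of `C`, fed by `hE`
      obtain ⟨c, hcC, hc⟩ := hC
      obtain ⟨x, hxC, hx, hmax⟩ := exists_maximal_point_not_isClosed C.isClosed hcC hc
      exact ⟨x, hxC, stub_roofEngineNonClosedStep g f C C.isClosed hηC hreg x hxC hmax
        (hE k M g hdim x hx X' f J hf)⟩
    · -- CLOSED STEP at the closed point `f x₁ ∈ C` under its regular roof, fed by `hA`
      push Not at hC
      obtain ⟨N, gN, q, I₀, -, hftN, hqcN, hintN, -, hqprop, hqbir, hdimN, hregN, -, hqI⟩ :=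
        hroof (f x₁) (hC _ hx₁C)
      haveI := hftN
      haveI := hqcN
      haveI := hintN
      haveI := hqprop
      exact ⟨f x₁, hx₁C, stub_roofEngineClosedStepBlowup p hB k gN hdimN q hqbir hqI f
        (hf.isBirational' hne) hf C hC hηC hreg (f x₁) hx₁C hregN⟩
  -- the composite `X'' → X' → M` is a blowing up along an ideal sheaf not supported at `η_M`
  obtain ⟨Q, hQ, hQsupp⟩ := hf.exists_isBlowup_comp hf'
  have hηQ : genericPoint M ∉ (Q.support : Set M) := fun h => (hQsupp h).elim hηJ hηJ'
  -- `X''` is of finite type over `k`: its singular locus is closed, with closed image `C'`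
  haveI : IsProper f' := hf'.isProper
  have hreg'' : IsClosed (Scheme.regularLocus X'')ᶜ :=
    isClosed_compl_regularLocus_of_locallyOfFiniteType ((f' ≫ f) ≫ g) hk
  let C' : Closeds M :=
    ⟨(f' ≫ f) '' (Scheme.regularLocus X'')ᶜ, (f' ≫ f).isClosedMap _ hreg''⟩
  -- `C' ⊆ C ∖ {x}`
  have hC'C : (C' : Set M) ⊆ (C : Set M) \ {x} := by
    rintro _ ⟨x'', hx'', rfl⟩
    obtain ⟨h1, h2⟩ := hstep x'' hx''
    exact ⟨by rwa [Scheme.Hom.comp_apply], by rwa [Set.mem_singleton_iff, Scheme.Hom.comp_apply]⟩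
  have hlt : C' < C := by
    refine lt_of_le_of_ne (fun y hy => (hC'C hy).1) fun h => ?_
    have hx' : x ∈ (C' : Set M) := by
      rw [h]
      exact hxC
    exact (hC'C hx').2 rfl
  exact ih C' hlt (fun y hy => hCT (hC'C hy).1)
    ⟨X'', f' ≫ f, Q, hQ, hηQ, fun x'' hx'' => by
      by_contra h
      exact hx'' ⟨x'', h, rfl⟩⟩

end Summit.ResolutionOfSingularities.ResolutionOfSingularities.Theorems

end
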